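import Summits.BirchSwinnertonDyer.BirchSwinnertonDyer.Theorems.AlignedTransportAtTwoMainConjectureOfRankZeroBSDAtTwoNarrowCubicNamedInput
import Summits.BirchSwinnertonDyer.BirchSwinnertonDyer.Theorems.AlignedTransportAtTwoMainConjectureOfRankZeroBSDAtTwoCubicChevalleyRowN1763ClassNumber
import Literature.NumberTheory.IwasawaTheory.NarrowDefectBoundedOfClassicalMuOneRealPlace
import Literature.NumberTheory.NumberFields.CubicFieldThreeRealPlaces
import HarnessLib

/-!
# Route `AlignedTransportAtTwo`, crux C2 `MainConjectureOfRankZeroBSDAtTwo` (stmt-BirchSwinnertonDyer-22298):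
# A KERNEL WITNESS FOR THE NAMED INPUT — the cubic field of discriminant `−1763` is a non-cyclic, non-totally-real cubic field with
# `μ₂ = 0` AND bounded narrow `2`-defect along every cyclotomic `ℤ₂`-extension, UNCONDITIONALLY

HONEST FRAMING. WIDTH-5 attached prover seat `bsd-line-att-p4` g33 on line `birth`; `--supports` stmt-BirchSwinnertonDyer-22298, closes nothing; BSD is NOT
proved; crux C2, its verdict and every registered stub untouched. THEOREMS ONLY. This file asserts NOTHING about the named conjecture
«narrow `μ₂⁺ = 0` for every non-cyclic cubic field» beyond exhibiting ONE field inside its binder class for which the conclusion is a theorem of the tree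
(a non-vacuity / consistency witness for the planner's filing, D-0033 BC5-style): the cubic `2`-torsion field `ℚ(β)` of the seed `[1, 0, 1, −3, −3]`
(`N = 1763`, `Δ = −1763`), whose `μ₂ = 0` is att-p5 g32 / att-p4 g27's UNCONDITIONAL `classicalMuVanishes_cubicField_n1763` (class number one + Chevalley's
non-norm unit + Fukuda), and whose narrow clause follows by this seat's `exists_narrowDefect_le_of_classicalMu_of_not_isTotallyReal_cubic` (one real place).

* `not_isGalois_cubicField_n1763`, `not_isTotallyReal_cubicField_n1763` — `ℚ(β)` is an `S₃`-cubic with one real place;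
* ★ `narrowMu_witness_n1763` — `[ℚ(β):ℚ] = 3 ∧ ¬ IsGalois ∧ ¬ IsTotallyReal ∧ (a) μ₂ = 0 ∀ cyclotomic κ ∧ (b) bounded narrow 2-defect`;
* ★ `exists_nonGalois_cubicField_narrowMu` — **∃ a non-Galois cubic number field satisfying the conclusion of the named input** (so the input is not
  refuted by its first instance, and its binder class is inhabited).
PARTITION: none; beyond-print theorem: no; BSD is NOT proved by any of this.

References: [Fukuda1994] Thm. 1 (1); [LMFDB] number field 3.1.1763.1; [Kida1982JFields] Thm. 1; [Iwasawa1973MuInvariants] Thm. 3; tree: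
`…CubicChevalleyRowN1763{,ClassNumber}`, `…NarrowCubicNamedInput`, `NarrowDefectBoundedOfClassicalMuOneRealPlace`, `CubicFieldThreeRealPlaces`.
-/

-- the Theorems namespace of this sub repeats the summit name by design (D-0017 nested layout)
set_option linter.dupNamespace false
set_option autoImplicit false

noncomputable section

open scoped NumberField IntermediateField

namespace Summit.BirchSwinnertonDyer.BirchSwinnertonDyer.Theorems.AlignedTransportAtTwoNarrowCubicNamedInputWitness

open NumberField Polynomial WeierstrassCurve IntermediateField Field
  Literature.NumberTheory.EllipticCurves Literature.NumberTheory.EllipticCurves.Greenberg1999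
  Literature.NumberTheory.EllipticCurves.DokchitserDokchitser2012
  Literature.NumberTheory.EllipticCurves.ZpExtension Literature.NumberTheory.GaloisRepresentations
  Literature.NumberTheory.IwasawaTheory Literature.NumberTheory.NumberFields
  Summit.BirchSwinnertonDyer.BirchSwinnertonDyer.Theorems.AlignedTransportAtTwoFineRoad.DivisionCubic
  Summit.BirchSwinnertonDyer.BirchSwinnertonDyer.Theorems.AlignedTransportAtTwoNarrowCubicNamedInput
  Summit.BirchSwinnertonDyer.BirchSwinnertonDyer.Theorems.AlignedTransportAtTwoCubicChevalleyRowN1763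
  Summit.BirchSwinnertonDyer.BirchSwinnertonDyer.Theorems.AlignedTransportAtTwoCubicChevalleyRowN1763ClassNumber

/-- **`ℚ(β)` (`β` a root of the `2`-division cubic of `[1,0,1,−3,−3]`) is NOT Galois over `ℚ`** (`Δ = −1763 ∉ ℚ²`, no rational `2`-torsion; `β` is one of the
`xT`'s and `…NarrowCubicNamedInput.not_isGalois_adjoin_xT`). [cite: LMFDB, number field 3.1.1763.1] [cite: SilvermanAEC2009, III.§1] -/
theorem not_isGalois_cubicField_n1763 {β : AlgebraicClosure ℚ}
    (hβ : aeval β ((⟨1, 0, 1, -3, -3⟩ : WeierstrassCurve ℤ).baseChange ℚ).twoTorsionPolynomial.toPoly = 0) :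
    ¬ IsGalois ℚ ↥(IntermediateField.adjoin ℚ ({β} : Set (AlgebraicClosure ℚ))) := by
  haveI := isElliptic_n1763
  set W : WeierstrassCurve ℚ := (⟨1, 0, 1, -3, -3⟩ : WeierstrassCurve ℤ).baseChange ℚ with hW
  have hsq : ¬ IsSquare W.Δ := fun ⟨r, hr⟩ ↦ by nlinarith [mul_self_nonneg r, Δ_n1763_neg]
  have hmem : β ∈ W.twoTorsionPolynomial.toPoly.rootSet (AlgebraicClosure ℚ) :=
    Polynomial.mem_rootSet.mpr ⟨twoTorsionPolynomial_toPoly_ne_zero W two_ne_zero, hβ⟩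
  obtain ⟨j, rfl⟩ : β ∈ Set.range (xT W two_ne_zero) := (range_xT_eq_rootSet W two_ne_zero).symm.subset hmem
  exact not_isGalois_adjoin_xT W not_hasRationalTwoTorsionX_n1763 hsq j

/-- **`ℚ(β)` is NOT totally real** (the `2`-division cubic `4x³ + x² − 10x − 11` has discriminant `16Δ = −16·1763 < 0`: one real root).
[cite: Cohen1993, Prop. 4.8.11] [cite: LMFDB, number field 3.1.1763.1] -/
theorem not_isTotallyReal_cubicField_n1763 {β : AlgebraicClosure ℚ}
    (hβ : aeval β ((⟨1, 0, 1, -3, -3⟩ : WeierstrassCurve ℤ).baseChange ℚ).twoTorsionPolynomial.toPoly = 0) :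
    haveI : FiniteDimensional ℚ (IntermediateField.adjoin ℚ ({β} : Set (AlgebraicClosure ℚ))) :=
      IntermediateField.adjoin.finiteDimensional ((AlgebraicClosure.isAlgebraic ℚ).isAlgebraic β).isIntegral
    haveI : NumberField (IntermediateField.adjoin ℚ ({β} : Set (AlgebraicClosure ℚ))) := NumberField.mk
    ¬ IsTotallyReal ↥(IntermediateField.adjoin ℚ ({β} : Set (AlgebraicClosure ℚ))) :=
  not_isTotallyReal_adjoin_of_cubic_discr_neg (P := ((⟨1, 0, 1, -3, -3⟩ : WeierstrassCurve ℤ).baseChange ℚ).twoTorsionPolynomial)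
    (by simp [WeierstrassCurve.twoTorsionPolynomial])
    (by rw [WeierstrassCurve.twoTorsionPolynomial_discr]; nlinarith [Δ_n1763_neg]) hβ (finrank_cubicField_n1763 hβ)

/-- ★ **THE WITNESS**: for every root `β ∈ ℚ̄` of the `2`-division cubic of `[1,0,1,−3,−3]`, the field `F = ℚ(β)` has `[F:ℚ] = 3`, is NOT Galois over `ℚ`, is NOT
totally real, and satisfies UNCONDITIONALLY (a) `μ₂ = 0` (growth form) for every cyclotomic `ℤ₂`-extension (att-p5/att-p4: `h = 1`, non-norm unit, Fukuda) and
(b) a bounded narrow `2`-defect along them (this seat's one-real-place theorem) — i.e. the conclusion of the named input «narrow `μ₂⁺ = 0` for every non-cyclic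
cubic field» holds for this field. [cite: Fukuda1994, Thm. 1 (1), p. 264] [cite: Kida1982JFields, Thm. 1 (p. 340)] [cite: LMFDB, number field 3.1.1763.1 (class number 1)] -/
theorem narrowMu_witness_n1763 {β : AlgebraicClosure ℚ}
    (hβ : aeval β ((⟨1, 0, 1, -3, -3⟩ : WeierstrassCurve ℤ).baseChange ℚ).twoTorsionPolynomial.toPoly = 0) :
    haveI : FiniteDimensional ℚ (IntermediateField.adjoin ℚ ({β} : Set (AlgebraicClosure ℚ))) :=
      IntermediateField.adjoin.finiteDimensional ((AlgebraicClosure.isAlgebraic ℚ).isAlgebraic β).isIntegral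
    haveI : NumberField (IntermediateField.adjoin ℚ ({β} : Set (AlgebraicClosure ℚ))) := NumberField.mk
    Module.finrank ℚ ↥(IntermediateField.adjoin ℚ ({β} : Set (AlgebraicClosure ℚ))) = 3 ∧
      ¬ IsGalois ℚ ↥(IntermediateField.adjoin ℚ ({β} : Set (AlgebraicClosure ℚ))) ∧
      ¬ IsTotallyReal ↥(IntermediateField.adjoin ℚ ({β} : Set (AlgebraicClosure ℚ))) ∧
      (∀ κ : ZpExtension ↥(IntermediateField.adjoin ℚ ({β} : Set (AlgebraicClosure ℚ))) 2, κ.IsCyclotomic → ClassicalMuVanishes κ) ∧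
      ∃ D : ℕ, ∀ κ : ZpExtension ↥(IntermediateField.adjoin ℚ ({β} : Set (AlgebraicClosure ℚ))) 2, κ.IsCyclotomic →
        ∀ n : ℕ, ∀ [NumberField ↥(κ.layer n)],
          padicValNat 2 (narrowClassNumber ↥(κ.layer n)) ≤ padicValNat 2 (NumberField.classNumber ↥(κ.layer n)) + D := by
  haveI : FiniteDimensional ℚ (IntermediateField.adjoin ℚ ({β} : Set (AlgebraicClosure ℚ))) :=
    IntermediateField.adjoin.finiteDimensional ((AlgebraicClosure.isAlgebraic ℚ).isAlgebraic β).isIntegral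
  haveI : NumberField (IntermediateField.adjoin ℚ ({β} : Set (AlgebraicClosure ℚ))) := NumberField.mk
  have h3 := finrank_cubicField_n1763 hβ
  have hnR := not_isTotallyReal_cubicField_n1763 hβ
  have hμ : ∀ κ : ZpExtension ↥(IntermediateField.adjoin ℚ ({β} : Set (AlgebraicClosure ℚ))) 2, κ.IsCyclotomic → ClassicalMuVanishes κ :=
    fun κ hκ ↦ classicalMuVanishes_cubicField_n1763 hβ κ hκ
  exact ⟨h3, not_isGalois_cubicField_n1763 hβ, hnR, hμ,
    exists_narrowDefect_le_of_classicalMu_of_not_isTotallyReal_cubic _ h3 hnR hμ⟩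

/-- ★ **THE NAMED INPUT HAS AN UNCONDITIONAL INSTANCE**: there is a cubic number field (inside `ℚ̄`), NOT Galois over `ℚ`, with (a) `μ₂ = 0` for every cyclotomic
`ℤ₂`-extension and (b) a bounded narrow `2`-defect along them — the conclusion of «narrow `μ₂⁺ = 0` for every non-cyclic cubic field» holds for the cubic field of
discriminant `−1763`. Nothing is asserted about the other fields of the binder class. [cite: Fukuda1994, Thm. 1 (1), p. 264] [cite: LMFDB, number field 3.1.1763.1] -/
theorem exists_nonGalois_cubicField_narrowMu :
    ∃ F : IntermediateField ℚ (AlgebraicClosure ℚ), ∃ _ : FiniteDimensional ℚ ↥F,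
      Module.finrank ℚ ↥F = 3 ∧ ¬ IsGalois ℚ ↥F ∧
      (∀ κ : ZpExtension ↥F 2, κ.IsCyclotomic → ClassicalMuVanishes κ) ∧
      ∃ D : ℕ, ∀ κ : ZpExtension ↥F 2, κ.IsCyclotomic → ∀ n : ℕ, ∀ [NumberField ↥(κ.layer n)],
        padicValNat 2 (narrowClassNumber ↥(κ.layer n)) ≤ padicValNat 2 (NumberField.classNumber ↥(κ.layer n)) + D := by
  obtain ⟨β, hβ⟩ := exists_root_twoTorsionPolynomial_n1763
  haveI : FiniteDimensional ℚ (IntermediateField.adjoin ℚ ({β} : Set (AlgebraicClosure ℚ))) :=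
    IntermediateField.adjoin.finiteDimensional ((AlgebraicClosure.isAlgebraic ℚ).isAlgebraic β).isIntegral
  obtain ⟨h3, hG, -, hμ, hD⟩ := narrowMu_witness_n1763 hβ
  exact ⟨_, inferInstance, h3, hG, hμ, hD⟩

end Summit.BirchSwinnertonDyer.BirchSwinnertonDyer.Theorems.AlignedTransportAtTwoNarrowCubicNamedInputWitness

end
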